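import Literature.Geometry.GeometricMeasureTheory.HausdorffFinite
import Literature.Geometry.Lorentzian.VolumeChartFormula
import Mathlib.Geometry.Euclidean.Volume.Measure
import Mathlib.MeasureTheory.Measure.Lebesgue.EqHaar
import Mathlib.MeasureTheory.Constructions.Polish.Basic
import Mathlib.Analysis.Calculus.MeanValue
import Mathlib.Analysis.InnerProductSpace.PiL2
import Mathlib.Analysis.InnerProductSpace.NormDet
import HarnessLib

/-!
# The area formula for injective `C¹` immersions: `𝓗ⁿ(F(S)) = ∫_S J F`

Let `P` be an `n`-dimensional real inner product space, `V` a real inner product space, `U ⊆ P`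
open and `F : P → V` differentiable on `U` with derivative `F' : P → (P →L[ℝ] V)` continuous on
`U`, injective on `U` and immersive on `U` (`F' x` injective for `x ∈ U`). Then for every
measurable `S ⊆ U`

  `μHE[n] (F '' S) = ∫⁻ x in S, √(det (⟪F' x bᵢ, F' x bⱼ⟫)ᵢⱼ) dx`

(`euclideanHausdorffMeasure_image_eq_lintegral_sqrt_det_gram`), where `μHE[n]` is Mathlib's
Euclidean-normalised `n`-dimensional Hausdorff measure on `V`, `dx` is Lebesgue measure on `P`
(`volume = μHE[n]`), `b` is any orthonormal basis of `P`, and the integrand — the `n`-dimensional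
Jacobian `J F(x) = ‖∧ⁿ F'(x)‖ = √(det (F'(x)ᵀ F'(x)))` — is written as the square root of the Gram
determinant of the vectors `F'(x) bᵢ`. This is the special case of Federer's area formula
[Federer1969, 3.2.3, 3.2.5] for injective `C¹` immersions (the general Lipschitz statement with
multiplicities is not needed downstream); Evans–Gariepy, *Measure Theory and Fine Properties of
Functions*, §3.3 Thm. 1–2.

The same statements with the integrand written as Mathlib's norm determinant
`(F' x).normDet = √(det (⟪F' x bᵢ, F' x bⱼ⟫))` (`LinearMap.normDet_sq_eq_det_gram`) are
`euclideanHausdorffMeasure_image_eq_lintegral_normDet`, `map_withDensity_normDet_eq_restrict_image`,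
`lintegral_image_eq_lintegral_mul_normDet` (and `…_normDet_fderiv` for `ContDiffOn ℝ 1` maps); the
linear case is also Mathlib's `LinearMap.euclideanHausdorffMeasure_image`.

Also the linear case (`euclideanHausdorffMeasure_image_continuousLinearMap`): for every continuous
linear `A : P → V` and every `s ⊆ P`, `μHE[n] (A '' s) = √(det (⟪A bᵢ, A bⱼ⟫)ᵢⱼ) · μHE[n] s`
(if `A` is not injective both sides vanish).

## Proof

As for the chart formula of the Riemannian measure (`Literature/Geometry/Lorentzian/VolumeChartFormula.lean`,
whose Gram identity `det (⟪A bᵢ, A bⱼ⟫) = (det A)²` and assembly we reuse):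
1. *Linear algebra.* An injective `A : P →L[ℝ] V` factors as `A = ι ∘ E` with `E` a linear
   endomorphism of `P` and `ι : P → V` a linear isometry (orthonormal bases of `P` and of
   `range A`); hence `μHE[n] (A s) = μHE[n] (E s) = |det E| vol s` (isometry invariance of `μHE`,
   Mathlib's `addHaar_image_continuousLinearMap`) and `det (⟪A bᵢ, A bⱼ⟫) = (det E)²`.
2. *Local bi-Lipschitz comparison.* At `x₀ ∈ U`, `A = F' x₀` is `K`-antilipschitz; for `C > 1`
   put `η = 1 - 1/C`, `ε = η / K`; on a ball around `x₀` where `‖F' y - A‖ ≤ ε` the mean value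
   inequality gives `‖F y - F y' - A (y - y')‖ ≤ η ‖A (y - y')‖`, so `F ∘ A⁻¹` is `C`-Lipschitz on
   `A (ball)` and `A ∘ F⁻¹` is `C`-Lipschitz on `F (ball)`: `μH (F s) ≤ Cⁿ μH (A s)` and
   `μH (A s) ≤ Cⁿ μH (F s)` for `s ⊆ ball` (`LipschitzOnWith.hausdorffMeasure_image_le`).
3. *Density.* `x ↦ √(det (⟪F' x bᵢ, F' x bⱼ⟫))` is continuous and positive on `U`, so on a smaller
   ball it is within a factor `C` of its value `√(det (⟪A bᵢ, A bⱼ⟫))` at `x₀`.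
4. *Assembly.* 2–3 give `μHE[n] (F s) ≤ Cⁿ⁺¹ ∫_s J F` and `∫_s J F ≤ Cⁿ⁺¹ μHE[n] (F s)` for
   measurable `s` in a small ball around each point of `U`; a countable subcover of `U`, a
   disjointification and the Lusin–Souslin theorem (measurability of the injective continuous
   images `F (T k)`, Mathlib's `MeasurableSet.image_of_continuousOn_injOn`) give both inequalities
   for `S`, and `C ↓ 1` gives equality.

Theorems only (no definitions, no named facts).

## References

* H. Federer, *Geometric Measure Theory*, Springer 1969, 2.10.11, 3.2.3, 3.2.5 [Federer1969]
  (held: `lit book:federernd-geometric-measure-theory`).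
* L. C. Evans, R. F. Gariepy, *Measure Theory and Fine Properties of Functions*, CRC 1992, §3.3.
-/

open scoped ENNReal NNReal Topology RealInnerProductSpace
open Set Filter Function MeasureTheory MeasureTheory.Measure Module

noncomputable section

namespace Literature.Geometry.GeometricMeasureTheory

/-! ### Linear algebra: Gram determinants and isometric factorisation -/

section GramLinear

variable {P V : Type*} [NormedAddCommGroup P] [InnerProductSpace ℝ P]
  [NormedAddCommGroup V] [InnerProductSpace ℝ V]
  {ι : Type*} [Fintype ι] [DecidableEq ι]

/-- The Gram determinant of a linearly dependent family vanishes: if `A : P → V` is linear and not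
injective then `det (⟪A bᵢ, A bⱼ⟫)ᵢⱼ = 0` for every basis-like family `b` spanning `P`; here for
an orthonormal basis `b` of `P`. [folklore] -/
theorem det_gram_eq_zero_of_not_injective (b : OrthonormalBasis ι ℝ P) (A : P →ₗ[ℝ] V)
    (hA : ¬ Injective A) :
    (Matrix.of fun i j => ⟪A (b i), A (b j)⟫).det = 0 := by
  -- a nonzero kernel vector `w`, with coordinates `c = b.repr w ≠ 0`
  have hker : LinearMap.ker A ≠ ⊥ := by rwa [Ne, LinearMap.ker_eq_bot]
  obtain ⟨w, hw, hw0⟩ := Submodule.exists_mem_ne_zero_of_ne_bot hker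
  rw [LinearMap.mem_ker] at hw
  set c : ι → ℝ := fun i => b.repr w i with hc
  have hc0 : c ≠ 0 := by
    intro h
    apply hw0
    have : b.repr w = 0 := by
      ext i; exact congr_fun h i
    simpa using this
  have hsum : ∑ j, c j • b j = w := by
    simp only [hc]
    exact b.sum_repr w
  refine (Matrix.exists_mulVec_eq_zero_iff).1 ⟨c, hc0, ?_⟩
  ext i
  simp only [Matrix.mulVec, dotProduct, Matrix.of_apply, Pi.zero_apply]
  calc ∑ j, ⟪A (b i), A (b j)⟫ * c j = ⟪A (b i), A (∑ j, c j • b j)⟫ := by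
        rw [_root_.map_sum, inner_sum]
        refine Finset.sum_congr rfl fun j _ => ?_
        rw [_root_.map_smul, real_inner_smul_right, mul_comm]
    _ = 0 := by rw [hsum, hw, inner_zero_right]

/-- In an isometric factorisation `A = ι ∘ E`, Gram matrices agree: `⟪A v, A w⟫ = ⟪E v, E w⟫`.
[folklore] -/
theorem inner_eq_of_linearIsometry_comp {A : P →L[ℝ] V} {E : P →L[ℝ] P} {ι' : P →ₗᵢ[ℝ] V}
    (h : ∀ w, ι' (E w) = A w) (v w : P) : ⟪A v, A w⟫ = ⟪E v, E w⟫ := by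
  rw [← h v, ← h w, LinearIsometry.inner_map_map]

/-- In an isometric factorisation `A = ι ∘ E`, the Gram density of `A` in an orthonormal basis
is `|det E|`. [folklore] -/
theorem sqrt_det_gram_eq_abs_det_of_linearIsometry_comp (b : OrthonormalBasis ι ℝ P)
    {A : P →L[ℝ] V} {E : P →L[ℝ] P} {ι' : P →ₗᵢ[ℝ] V} (h : ∀ w, ι' (E w) = A w) :
    Real.sqrt (Matrix.of fun i j => ⟪A (b i), A (b j)⟫).det = |LinearMap.det (E : P →ₗ[ℝ] P)| := by
  rw [← Literature.Geometry.Lorentzian.sqrt_det_gram_eq_abs_det b (E : P →ₗ[ℝ] P)]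
  congr 3
  ext i j
  exact inner_eq_of_linearIsometry_comp h (b i) (b j)

variable [FiniteDimensional ℝ P]

/-- **Isometric factorisation of an injective linear map.** An injective continuous linear map
`A : P → V` from a finite-dimensional inner product space factors as `A = ι ∘ E` with `E` a
continuous linear endomorphism of `P` and `ι : P → V` a linear isometry (compose the
corestriction of `A` to its range with a linear isometry `range A ≃ P`, which exists because the
two spaces have the same finite dimension). [folklore] -/
theorem exists_linearIsometry_comp_eq_of_injective (A : P →L[ℝ] V) (hA : Injective A) :
    ∃ (E : P →L[ℝ] P) (ι : P →ₗᵢ[ℝ] V), ∀ w, ι (E w) = A w := by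
  set Q : Submodule ℝ V := LinearMap.range (A : P →ₗ[ℝ] V) with hQ
  have hfin : finrank ℝ Q = finrank ℝ P := LinearMap.finrank_range_of_inj hA
  haveI : FiniteDimensional ℝ Q := by
    rw [hQ]; infer_instance
  set Φ : P ≃ₗᵢ[ℝ] Q :=
    (stdOrthonormalBasis ℝ P).equiv (stdOrthonormalBasis ℝ Q) (finCongr hfin.symm) with hΦ
  set A' : P →L[ℝ] Q := A.codRestrict Q (fun w => LinearMap.mem_range_self (A : P →ₗ[ℝ] V) w)
    with hA'
  refine ⟨(Φ.symm : Q →L[ℝ] P).comp A', Q.subtypeₗᵢ.comp Φ.toLinearIsometry, fun w => ?_⟩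
  simp [hA']

/-- The Gram density of an injective linear map is positive. [folklore] -/
theorem sqrt_det_gram_pos_of_injective (b : OrthonormalBasis ι ℝ P) (A : P →L[ℝ] V)
    (hA : Injective A) : 0 < Real.sqrt (Matrix.of fun i j => ⟪A (b i), A (b j)⟫).det := by
  obtain ⟨E, ι', h⟩ := exists_linearIsometry_comp_eq_of_injective A hA
  rw [sqrt_det_gram_eq_abs_det_of_linearIsometry_comp b h, abs_pos]
  have hE : Injective E := by
    intro v w hvw
    apply hA
    rw [← h v, ← h w, hvw]
  have hEb : Function.Bijective (E : P →ₗ[ℝ] P) :=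
    ⟨hE, LinearMap.surjective_of_injective hE⟩
  have : (E : P →ₗ[ℝ] P) = (LinearEquiv.ofBijective (E : P →ₗ[ℝ] P) hEb : P →ₗ[ℝ] P) := by
    ext w; rfl
  rw [this]
  exact (LinearEquiv.isUnit_det' _).ne_zero

end GramLinear

/-! ### The linear area formula -/

section LinearMeasure

variable {P V : Type*} [NormedAddCommGroup P] [InnerProductSpace ℝ P] [FiniteDimensional ℝ P]
  [MeasurableSpace P] [BorelSpace P]
  [NormedAddCommGroup V] [InnerProductSpace ℝ V] [MeasurableSpace V] [BorelSpace V]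
  {ι : Type*} [Fintype ι] [DecidableEq ι]

omit [FiniteDimensional ℝ P] in
/-- In an isometric factorisation `A = ι ∘ E`, `μH[d] (A s) = μH[d] (E s)` (isometries preserve
Hausdorff measure). [folklore] -/
theorem hausdorffMeasure_image_eq_of_linearIsometry_comp {A : P →L[ℝ] V} {E : P →L[ℝ] P}
    {ι' : P →ₗᵢ[ℝ] V} (h : ∀ w, ι' (E w) = A w) {d : ℝ} (hd : 0 ≤ d) (s : Set P) :
    μH[d] (A '' s) = μH[d] (E '' s) := by
  have himg : A '' s = ι' '' (E '' s) := by
    rw [image_image]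
    exact image_congr fun w _ => (h w).symm
  rw [himg, ι'.isometry.hausdorffMeasure_image (Or.inl hd)]

omit [FiniteDimensional ℝ P] in
/-- In an isometric factorisation `A = ι ∘ E`, `μHE[d] (A s) = μHE[d] (E s)`. [folklore] -/
theorem euclideanHausdorffMeasure_image_eq_of_linearIsometry_comp {A : P →L[ℝ] V} {E : P →L[ℝ] P}
    {ι' : P →ₗᵢ[ℝ] V} (h : ∀ w, ι' (E w) = A w) (d : ℕ) (s : Set P) :
    μHE[d] (A '' s) = μHE[d] (E '' s) := by
  have himg : A '' s = ι' '' (E '' s) := by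
    rw [image_image]
    exact image_congr fun w _ => (h w).symm
  rw [himg, ι'.isometry.euclideanHausdorffMeasure_image]

omit [MeasurableSpace P] [BorelSpace P] in
/-- The image of a non-injective linear map from an `n`-dimensional space is `μH[d]`-null for
every `d ≥ n` (it lies in a subspace of dimension `< n`). [folklore] -/
theorem hausdorffMeasure_image_eq_zero_of_not_injective (A : P →L[ℝ] V) (hA : ¬ Injective A)
    {d : ℝ} (hd : (finrank ℝ P : ℝ) ≤ d) (s : Set P) : μH[d] (A '' s) = 0 := by
  set Q : Submodule ℝ V := LinearMap.range (A : P →ₗ[ℝ] V) with hQ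
  haveI : FiniteDimensional ℝ Q := by
    rw [hQ]; infer_instance
  have hker : LinearMap.ker (A : P →ₗ[ℝ] V) ≠ ⊥ := by rwa [Ne, LinearMap.ker_eq_bot]
  have hkpos : 0 < finrank ℝ (LinearMap.ker (A : P →ₗ[ℝ] V)) := by
    rw [Module.finrank_pos_iff]
    exact (Submodule.nontrivial_iff_ne_bot).2 hker
  have hsum := LinearMap.finrank_range_add_finrank_ker (A : P →ₗ[ℝ] V)
  have hlt : (finrank ℝ Q : ℝ) < d := by
    have : finrank ℝ Q < finrank ℝ P := by rw [hQ]; omega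
    exact lt_of_lt_of_le (by exact_mod_cast this) hd
  have himg : A '' s = Q.subtypeₗᵢ '' ((A : P →ₗ[ℝ] V).rangeRestrict '' s) := by
    rw [image_image]
    exact image_congr fun w _ => rfl
  rw [himg]
  exact hausdorffMeasure_image_eq_zero_of_finrank_lt
    (Q.subtypeₗᵢ.lipschitz.lipschitzOnWith (s := (A : P →ₗ[ℝ] V).rangeRestrict '' s)) hlt

/-- **The linear area formula.** For a continuous linear map `A : P → V` from an `n`-dimensional
real inner product space into a real inner product space, and any `s ⊆ P`,
`μHE[n] (A s) = √(det (⟪A bᵢ, A bⱼ⟫)ᵢⱼ) · μHE[n] s` for every orthonormal basis `b` of `P`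
(`√(det Gram) = ‖∧ⁿ A‖` is the `n`-dimensional Jacobian of `A`). For injective `A` this is the
isometric factorisation `A = ι ∘ E` together with `vol (E s) = |det E| vol s`
(Mathlib's `addHaar_image_continuousLinearMap`); otherwise both sides vanish. Federer,
*Geometric Measure Theory* (1969), 3.2.3 (linear case, cf. 2.10.11, 3.2.1).
[cite: Federer1969, 3.2.3] -/
theorem euclideanHausdorffMeasure_image_continuousLinearMap (b : OrthonormalBasis ι ℝ P)
    (A : P →L[ℝ] V) (s : Set P) :
    μHE[finrank ℝ P] (A '' s) =
      ENNReal.ofReal (Real.sqrt (Matrix.of fun i j => ⟪A (b i), A (b j)⟫).det) *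
        μHE[finrank ℝ P] s := by
  by_cases hA : Injective A
  · obtain ⟨E, ι', h⟩ := exists_linearIsometry_comp_eq_of_injective A hA
    rw [euclideanHausdorffMeasure_image_eq_of_linearIsometry_comp h,
      sqrt_det_gram_eq_abs_det_of_linearIsometry_comp b h,
      InnerProductSpace.euclideanHausdorffMeasure_eq_volume]
    exact addHaar_image_continuousLinearMap volume E s
  · have h0 : (Matrix.of fun i j => ⟪A (b i), A (b j)⟫).det = 0 :=
      det_gram_eq_zero_of_not_injective b (A : P →ₗ[ℝ] V) hA
    rw [h0, Real.sqrt_zero, ENNReal.ofReal_zero, zero_mul, euclideanHausdorffMeasure_def,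
      Measure.smul_apply, hausdorffMeasure_image_eq_zero_of_not_injective A hA le_rfl s, smul_zero]

end LinearMeasure

/-! ### Local bi-Lipschitz comparison of a `C¹` immersion with its derivative -/

section Local

variable {P V : Type*} [NormedAddCommGroup P] [InnerProductSpace ℝ P] [FiniteDimensional ℝ P]
  [NormedAddCommGroup V] [InnerProductSpace ℝ V]

/-- **A `C¹` immersion is locally bi-Lipschitz-close to its derivative.** Let `F` be
differentiable on the open set `U` with derivative `F'` continuous on `U`, and let `A = F' x₀` be
injective (`x₀ ∈ U`). Then for every `C > 1` there is a ball `B(x₀, δ) ⊆ U` on which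
`‖F y - F y'‖ ≤ C ‖A (y - y')‖` and `‖A (y - y')‖ ≤ C ‖F y - F y'‖`: with `A` `K`-antilipschitz,
`η = 1 - 1/C` and `‖F' y - A‖ ≤ η / K` on the ball, the mean value inequality gives
`‖F y - F y' - A (y - y')‖ ≤ (η/K) ‖y - y'‖ ≤ η ‖A (y - y')‖`. Federer, *Geometric Measure Theory*
(1969), 3.2.2 (the linear approximation underlying the area formula); Evans–Gariepy §3.3
Lemma 2. [cite: Federer1969, 3.2.2] -/
theorem exists_ball_norm_sub_le_and_le {F : P → V} {F' : P → P →L[ℝ] V} {U : Set P}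
    (hU : IsOpen U) (hF : ∀ x ∈ U, HasFDerivAt F (F' x) x) (hF'c : ContinuousOn F' U) {x₀ : P}
    (hx₀ : x₀ ∈ U) (hA : Injective (F' x₀)) {C : ℝ≥0} (hC : 1 < C) :
    ∃ δ > 0, Metric.ball x₀ δ ⊆ U ∧ ∀ y ∈ Metric.ball x₀ δ, ∀ y' ∈ Metric.ball x₀ δ,
      ‖F y - F y'‖ ≤ C * ‖F' x₀ (y - y')‖ ∧ ‖F' x₀ (y - y')‖ ≤ C * ‖F y - F y'‖ := by
  set A : P →L[ℝ] V := F' x₀ with hAdef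
  obtain ⟨K, hKpos, hK⟩ :=
    (A : P →ₗ[ℝ] V).exists_antilipschitzWith (LinearMap.ker_eq_bot.2 hA)
  have hC1 : (1 : ℝ) < C := by exact_mod_cast hC
  have hC0 : (0 : ℝ) < C := zero_lt_one.trans hC1
  have hK0 : (0 : ℝ) < K := by exact_mod_cast hKpos
  -- the constants `η = 1 - 1/C ∈ (0,1)` and `ε = η / K`
  set η : ℝ := 1 - 1 / C with hη
  have hη0 : 0 < η := by
    have : 1 / (C : ℝ) < 1 := by rw [div_lt_one hC0]; exact hC1
    rw [hη]; linarith
  set ε : ℝ := η / K with hε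
  have hε0 : 0 < ε := by positivity
  -- a ball inside `U` on which `‖F' y - A‖ ≤ ε`
  have hcont : ContinuousAt F' x₀ := hF'c.continuousAt (hU.mem_nhds hx₀)
  obtain ⟨δ, hδ0, hδ⟩ : ∃ δ > 0, ∀ y ∈ Metric.ball x₀ δ, ‖F' y - A‖ ≤ ε ∧ y ∈ U := by
    have h1 : ∀ᶠ y in 𝓝 x₀, ‖F' y - A‖ ≤ ε := by
      have := (Metric.tendsto_nhds.1 hcont) ε hε0
      filter_upwards [this] with y hy
      rw [dist_eq_norm] at hy
      exact hy.le
    have h2 : ∀ᶠ y in 𝓝 x₀, y ∈ U := hU.mem_nhds hx₀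
    exact Metric.eventually_nhds_iff_ball.1 (h1.and h2)
  have hBU : Metric.ball x₀ δ ⊆ U := fun y hy => (hδ y hy).2
  refine ⟨δ, hδ0, hBU, fun y hy y' hy' => ?_⟩
  -- mean value inequality and antilipschitz estimate
  have hmv : ‖F y - F y' - A (y - y')‖ ≤ ε * ‖y - y'‖ :=
    (convex_ball x₀ δ).norm_image_sub_le_of_norm_hasFDerivWithin_le'
      (fun z hz => (hF z (hBU hz)).hasFDerivWithinAt) (fun z hz => (hδ z hz).1) hy' hy
  have hanti : ‖y - y'‖ ≤ K * ‖A (y - y')‖ := by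
    have := hK.le_mul_dist y y'
    rwa [dist_eq_norm, dist_eq_norm, ← map_sub] at this
  have hkey : ‖F y - F y' - A (y - y')‖ ≤ η * ‖A (y - y')‖ := by
    calc ‖F y - F y' - A (y - y')‖ ≤ ε * ‖y - y'‖ := hmv
      _ ≤ ε * (K * ‖A (y - y')‖) := by gcongr
      _ = η * ‖A (y - y')‖ := by rw [hε]; field_simp
  constructor
  · have h1 : ‖F y - F y'‖ ≤ (1 + η) * ‖A (y - y')‖ := by
      calc ‖F y - F y'‖ = ‖(F y - F y' - A (y - y')) + A (y - y')‖ := by rw [sub_add_cancel]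
        _ ≤ ‖F y - F y' - A (y - y')‖ + ‖A (y - y')‖ := norm_add_le _ _
        _ ≤ η * ‖A (y - y')‖ + ‖A (y - y')‖ := by gcongr
        _ = (1 + η) * ‖A (y - y')‖ := by ring
    have h2 : 1 + η ≤ C := by
      rw [hη, show (1 : ℝ) + (1 - 1 / C) = (2 * C - 1) / C by field_simp; ring,
        div_le_iff₀ hC0]
      nlinarith
    calc ‖F y - F y'‖ ≤ (1 + η) * ‖A (y - y')‖ := h1
      _ ≤ C * ‖A (y - y')‖ := by gcongr
  · have h1 : ‖A (y - y')‖ ≤ ‖F y - F y'‖ + η * ‖A (y - y')‖ := by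
      calc ‖A (y - y')‖ = ‖(F y - F y') - (F y - F y' - A (y - y'))‖ := by rw [sub_sub_cancel]
        _ ≤ ‖F y - F y'‖ + ‖F y - F y' - A (y - y')‖ := norm_sub_le _ _
        _ ≤ ‖F y - F y'‖ + η * ‖A (y - y')‖ := by gcongr
    -- `(1 - η) ‖A (y - y')‖ ≤ ‖F y - F y'‖` with `1 - η = 1 / C`
    have h2 : (1 / C) * ‖A (y - y')‖ ≤ ‖F y - F y'‖ := by
      have : (1 - η) * ‖A (y - y')‖ ≤ ‖F y - F y'‖ := by nlinarith [h1]
      rwa [hη, sub_sub_cancel] at this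
    rw [div_mul_eq_mul_div, one_mul, div_le_iff₀ hC0] at h2
    linarith [mul_comm ‖F y - F y'‖ (C : ℝ)]

omit [FiniteDimensional ℝ P] in
/-- An immersion is locally injective: on the ball of `exists_ball_norm_sub_le_and_le`, `F` is
injective. [folklore] -/
theorem injOn_of_norm_le_mul {F : P → V} {A : P →L[ℝ] V} (hA : Injective A) {B : Set P} {C : ℝ}
    (h : ∀ y ∈ B, ∀ y' ∈ B, ‖A (y - y')‖ ≤ C * ‖F y - F y'‖) : InjOn F B := by
  intro y hy y' hy' hyy'
  have := h y hy y' hy'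
  rw [hyy', sub_self, norm_zero, mul_zero] at this
  have h0 : A (y - y') = 0 := norm_le_zero_iff.1 this
  rw [map_sub, sub_eq_zero] at h0
  exact hA h0

variable [MeasurableSpace V] [BorelSpace V]

/-- **Hausdorff measures of `F s` and `F'(x₀) s` agree up to `C^d` near `x₀`.** Under the
hypotheses of `exists_ball_norm_sub_le_and_le`, for every `C > 1` there is a neighbourhood `U'`
of `x₀` in `U` such that for all `s ⊆ U'`: `μH[d] (F s) ≤ C^d μH[d] (A s)` and
`μH[d] (A s) ≤ C^d μH[d] (F s)`, `A = F' x₀` (`F ∘ A⁻¹` is `C`-Lipschitz on `A U'` and `A ∘ F⁻¹`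
is `C`-Lipschitz on `F U'`; Lipschitz maps expand `μH[d]` by at most `Lip^d`, Federer 2.10.11).
[cite: Federer1969, 2.10.11 and 3.2.2] -/
theorem exists_nhds_hausdorffMeasure_image_le_and_le {F : P → V} {F' : P → P →L[ℝ] V}
    {U : Set P} (hU : IsOpen U) (hF : ∀ x ∈ U, HasFDerivAt F (F' x) x)
    (hF'c : ContinuousOn F' U) {x₀ : P} (hx₀ : x₀ ∈ U) (hA : Injective (F' x₀)) {C : ℝ≥0}
    (hC : 1 < C) {d : ℝ} (hd : 0 ≤ d) :
    ∃ U' ∈ 𝓝 x₀, U' ⊆ U ∧ InjOn F U' ∧ ∀ s ⊆ U',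
      μH[d] (F '' s) ≤ (C : ℝ≥0∞) ^ d * μH[d] (F' x₀ '' s) ∧
      μH[d] (F' x₀ '' s) ≤ (C : ℝ≥0∞) ^ d * μH[d] (F '' s) := by
  obtain ⟨δ, hδ0, hBU, hδ⟩ := exists_ball_norm_sub_le_and_le hU hF hF'c hx₀ hA hC
  set A : P →L[ℝ] V := F' x₀ with hAdef
  set B := Metric.ball x₀ δ with hB
  have hinj : InjOn F B := injOn_of_norm_le_mul hA (fun y hy y' hy' => (hδ y hy y' hy').2)
  refine ⟨B, Metric.ball_mem_nhds x₀ hδ0, hBU, hinj, fun s hs => ?_⟩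
  -- `Ψ = F ∘ A⁻¹` is `C`-Lipschitz on `A B` and maps `A s` onto `F s`
  set Ψ : V → V := F ∘ Function.invFun A with hΨ
  have hΨA : ∀ y, Ψ (A y) = F y := fun y => by
    simp only [hΨ, Function.comp_apply, Function.leftInverse_invFun hA y]
  have hΨimg : Ψ '' (A '' s) = F '' s := by
    rw [image_image]; exact image_congr fun y _ => hΨA y
  have hΨlip : LipschitzOnWith C Ψ (A '' B) := by
    refine LipschitzOnWith.of_dist_le_mul fun v hv v' hv' => ?_
    obtain ⟨y, hy, rfl⟩ := hv
    obtain ⟨y', hy', rfl⟩ := hv'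
    rw [hΨA, hΨA, dist_eq_norm, dist_eq_norm, ← map_sub]
    exact (hδ y hy y' hy').1
  -- `Θ = A ∘ F⁻¹` is `C`-Lipschitz on `F B` and maps `F s` onto `A s`
  set Θ : V → V := A ∘ Function.invFunOn F B with hΘ
  have hΘF : ∀ y ∈ B, Θ (F y) = A y := fun y hy => by
    simp only [hΘ, Function.comp_apply, hinj.leftInvOn_invFunOn hy]
  have hΘimg : Θ '' (F '' s) = A '' s := by
    rw [image_image]; exact image_congr fun y hy => hΘF y (hs hy)
  have hΘlip : LipschitzOnWith C Θ (F '' B) := by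
    refine LipschitzOnWith.of_dist_le_mul fun v hv v' hv' => ?_
    obtain ⟨y, hy, rfl⟩ := hv
    obtain ⟨y', hy', rfl⟩ := hv'
    rw [hΘF y hy, hΘF y' hy', dist_eq_norm, dist_eq_norm, ← map_sub]
    exact (hδ y hy y' hy').2
  constructor
  · rw [← hΨimg]
    exact (hΨlip.mono (image_mono hs)).hausdorffMeasure_image_le hd
  · rw [← hΘimg]
    exact (hΘlip.mono (image_mono hs)).hausdorffMeasure_image_le hd

end Local

/-! ### The Jacobian density `√(det (⟪F' x bᵢ, F' x bⱼ⟫))` -/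

section Density

variable {P V : Type*} [NormedAddCommGroup P] [InnerProductSpace ℝ P]
  [NormedAddCommGroup V] [InnerProductSpace ℝ V]
  {ι : Type*} [Fintype ι] [DecidableEq ι]

/-- The Jacobian density `x ↦ √(det (⟪F' x bᵢ, F' x bⱼ⟫)ᵢⱼ)` of a continuous field of linear maps
is continuous. [folklore] -/
theorem continuousOn_sqrt_det_gram (b : OrthonormalBasis ι ℝ P) {F' : P → P →L[ℝ] V} {U : Set P}
    (hF'c : ContinuousOn F' U) :
    ContinuousOn (fun x => Real.sqrt (Matrix.of fun i j => ⟪F' x (b i), F' x (b j)⟫).det) U := by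
  let G : P → Matrix ι ι ℝ := fun x i j => ⟪F' x (b i), F' x (b j)⟫
  have hG : ContinuousOn G U :=
    continuousOn_pi.2 fun i => continuousOn_pi.2 fun j =>
      (hF'c.clm_apply continuousOn_const).inner (hF'c.clm_apply continuousOn_const)
  have hdet : ContinuousOn (fun x => (G x).det) U := (continuous_id.matrix_det).comp_continuousOn hG
  exact Real.continuous_sqrt.comp_continuousOn hdet

end Density

/-! ### The area formula -/

section AreaFormula

variable {P V : Type*} [NormedAddCommGroup P] [InnerProductSpace ℝ P] [FiniteDimensional ℝ P]
  [MeasurableSpace P] [BorelSpace P]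
  [NormedAddCommGroup V] [InnerProductSpace ℝ V] [MeasurableSpace V] [BorelSpace V]
  {ι : Type*} [Fintype ι] [DecidableEq ι]
  {F : P → V} {F' : P → P →L[ℝ] V} {U : Set P}

/-- **Local two-sided comparison of `μHE[n] (F s)` with `∫_s J F`.** Let `F` be differentiable on
the open set `U` with continuous derivative `F'`, `x₀ ∈ U` with `F' x₀` injective, and `C > 1`.
Then on some open neighbourhood `U' ⊆ U` of `x₀`, on which `F` is injective, every measurable
`s ⊆ U'` satisfies `μHE[n] (F s) ≤ Cⁿ⁺¹ ∫_s J F` and `∫_s J F ≤ Cⁿ⁺¹ μHE[n] (F s)`, where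
`n = dim P` and `J F(x) = √(det (⟪F' x bᵢ, F' x bⱼ⟫)ᵢⱼ)`: combine the bi-Lipschitz comparison
`exists_nhds_hausdorffMeasure_image_le_and_le`, the linear area formula for `F' x₀`, and the
continuity of the (positive) density. Federer, *Geometric Measure Theory* (1969), 3.2.3.
[cite: Federer1969, 3.2.3] -/
theorem exists_isOpen_euclideanHausdorffMeasure_image_le_and_lintegral_le
    (b : OrthonormalBasis ι ℝ P) (hU : IsOpen U) (hF : ∀ x ∈ U, HasFDerivAt F (F' x) x)
    (hF'c : ContinuousOn F' U) {x₀ : P} (hx₀ : x₀ ∈ U) (hA : Injective (F' x₀)) {C : ℝ≥0}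
    (hC : 1 < C) :
    ∃ U' : Set P, IsOpen U' ∧ x₀ ∈ U' ∧ U' ⊆ U ∧ InjOn F U' ∧ ∀ s ⊆ U', MeasurableSet s →
      μHE[finrank ℝ P] (F '' s) ≤ (C : ℝ≥0∞) ^ (finrank ℝ P) * C *
          ∫⁻ x in s, ENNReal.ofReal (Real.sqrt (Matrix.of fun i j => ⟪F' x (b i), F' x (b j)⟫).det) ∧
      ∫⁻ x in s, ENNReal.ofReal (Real.sqrt (Matrix.of fun i j => ⟪F' x (b i), F' x (b j)⟫).det) ≤
          (C : ℝ≥0∞) ^ (finrank ℝ P) * C * μHE[finrank ℝ P] (F '' s) := by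
  set n := finrank ℝ P with hn
  set ρ : P → ℝ := fun x => Real.sqrt (Matrix.of fun i j => ⟪F' x (b i), F' x (b j)⟫).det
    with hρ_def
  set A : P →L[ℝ] V := F' x₀ with hAdef
  obtain ⟨U₁, hU₁, hU₁s, hinj₁, hH⟩ :=
    exists_nhds_hausdorffMeasure_image_le_and_le hU hF hF'c hx₀ hA hC (d := (n : ℝ))
      (Nat.cast_nonneg n)
  -- continuity and positivity of the density at `x₀`
  set ρ₀ := ρ x₀ with hρ₀_def
  have hρ₀ : 0 < ρ₀ := sqrt_det_gram_pos_of_injective b A hA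
  have hC1 : (1 : ℝ) < C := by exact_mod_cast hC
  have hC0 : (0 : ℝ) < C := zero_lt_one.trans hC1
  have hcont : ContinuousAt ρ x₀ :=
    (continuousOn_sqrt_det_gram b hF'c).continuousAt (hU.mem_nhds hx₀)
  have hU₂ : {x | ρ x < C * ρ₀ ∧ ρ₀ < C * ρ x} ∈ 𝓝 x₀ := by
    have h1 : ∀ᶠ x in 𝓝 x₀, ρ x < C * ρ₀ := hcont.eventually (gt_mem_nhds (by nlinarith))
    have h2 : ∀ᶠ x in 𝓝 x₀, ρ₀ / C < ρ x :=
      hcont.eventually (lt_mem_nhds (by rw [div_lt_iff₀ hC0]; nlinarith))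
    filter_upwards [h1, h2] with x hx1 hx2
    refine ⟨hx1, ?_⟩
    rw [div_lt_iff₀ hC0] at hx2
    linarith [mul_comm (ρ x) (C : ℝ)]
  set U' := interior (U₁ ∩ {x | ρ x < C * ρ₀ ∧ ρ₀ < C * ρ x}) with hU'_def
  have hU'U₁ : U' ⊆ U₁ := interior_subset.trans inter_subset_left
  refine ⟨U', isOpen_interior, mem_interior_iff_mem_nhds.2 (inter_mem hU₁ hU₂),
    hU'U₁.trans hU₁s, hinj₁.mono hU'U₁, fun s hs hsm => ?_⟩
  have hs₁ : s ⊆ U₁ := hs.trans hU'U₁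
  have hs₂ : ∀ x ∈ s, ρ x < C * ρ₀ ∧ ρ₀ < C * ρ x := fun x hx => (interior_subset (hs hx)).2
  obtain ⟨h1, h2⟩ := hH s hs₁
  rw [ENNReal.rpow_natCast] at h1 h2
  -- the linear area formula for `A`
  have hvol : (μHE[n] : Measure V) (A '' s) = ENNReal.ofReal ρ₀ * volume s := by
    rw [hn, euclideanHausdorffMeasure_image_continuousLinearMap b A s,
      InnerProductSpace.euclideanHausdorffMeasure_eq_volume]
  -- density bounds on `s`
  have hg_le : ∀ x ∈ s, ENNReal.ofReal (ρ x) ≤ C * ENNReal.ofReal ρ₀ := by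
    intro x hx
    rw [← ENNReal.ofReal_coe_nnreal, ← ENNReal.ofReal_mul hC0.le]
    exact ENNReal.ofReal_le_ofReal (hs₂ x hx).1.le
  have hg_ge : ∀ x ∈ s, ENNReal.ofReal ρ₀ ≤ C * ENNReal.ofReal (ρ x) := by
    intro x hx
    rw [← ENNReal.ofReal_coe_nnreal, ← ENNReal.ofReal_mul hC0.le]
    exact ENNReal.ofReal_le_ofReal (hs₂ x hx).2.le
  have hI_le : ∫⁻ x in s, ENNReal.ofReal (ρ x) ≤ C * ENNReal.ofReal ρ₀ * volume s := by
    calc ∫⁻ x in s, ENNReal.ofReal (ρ x)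
        ≤ ∫⁻ _ in s, C * ENNReal.ofReal ρ₀ := setLIntegral_mono' hsm hg_le
      _ = C * ENNReal.ofReal ρ₀ * volume s := setLIntegral_const _ _
  have hI_ge : ENNReal.ofReal ρ₀ * volume s ≤ C * ∫⁻ x in s, ENNReal.ofReal (ρ x) := by
    calc ENNReal.ofReal ρ₀ * volume s = ∫⁻ _ in s, ENNReal.ofReal ρ₀ := (setLIntegral_const _ _).symm
      _ ≤ ∫⁻ x in s, C * ENNReal.ofReal (ρ x) := setLIntegral_mono' hsm hg_ge
      _ = C * ∫⁻ x in s, ENNReal.ofReal (ρ x) := lintegral_const_mul' _ _ ENNReal.coe_ne_top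
  -- `μHE = c • μH` on `V`
  set c : ℝ≥0∞ :=
    (addHaarScalarFactor (volume : Measure (EuclideanSpace ℝ (Fin n))) μH[n] : ℝ≥0∞) with hc
  have hF₁ : (μHE[n] : Measure V) (F '' s) = c * μH[n] (F '' s) := by
    rw [euclideanHausdorffMeasure_def, Measure.smul_apply, ENNReal.smul_def, smul_eq_mul]
  have hA₁ : (μHE[n] : Measure V) (A '' s) = c * μH[n] (A '' s) := by
    rw [euclideanHausdorffMeasure_def, Measure.smul_apply, ENNReal.smul_def, smul_eq_mul]
  constructor
  · calc (μHE[n] : Measure V) (F '' s) = c * μH[n] (F '' s) := hF₁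
      _ ≤ c * ((C : ℝ≥0∞) ^ n * μH[n] (A '' s)) := by gcongr
      _ = (C : ℝ≥0∞) ^ n * (μHE[n] : Measure V) (A '' s) := by rw [hA₁]; ring
      _ = (C : ℝ≥0∞) ^ n * (ENNReal.ofReal ρ₀ * volume s) := by rw [hvol]
      _ ≤ (C : ℝ≥0∞) ^ n * (C * ∫⁻ x in s, ENNReal.ofReal (ρ x)) := by gcongr
      _ = (C : ℝ≥0∞) ^ n * C * ∫⁻ x in s, ENNReal.ofReal (ρ x) := by rw [mul_assoc]
  · calc ∫⁻ x in s, ENNReal.ofReal (ρ x) ≤ C * ENNReal.ofReal ρ₀ * volume s := hI_le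
      _ = C * (μHE[n] : Measure V) (A '' s) := by rw [hvol, mul_assoc]
      _ = C * (c * μH[n] (A '' s)) := by rw [hA₁]
      _ ≤ C * (c * ((C : ℝ≥0∞) ^ n * μH[n] (F '' s))) := by gcongr
      _ = (C : ℝ≥0∞) ^ n * C * (c * μH[n] (F '' s)) := by ring
      _ = (C : ℝ≥0∞) ^ n * C * (μHE[n] : Measure V) (F '' s) := by rw [hF₁]

omit [InnerProductSpace ℝ V] in
/-- Continuous injective images of Borel subsets of `U` under `F` are Borel (Lusin–Souslin; `P` is
Polish). [folklore] -/
theorem measurableSet_image_of_injOn (hFc : ContinuousOn F U)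
    (hinj : InjOn F U) {s : Set P} (hs : MeasurableSet s) (hsU : s ⊆ U) :
    MeasurableSet (F '' s) :=
  hs.image_of_continuousOn_injOn (hFc.mono hsU) (hinj.mono hsU)

/-- **Global two-sided comparison, for every `C > 1`.** If `F` is differentiable on the open set
`U` with continuous derivative `F'`, injective on `U` and immersive on `U`, then for every
measurable `S ⊆ U`: `μHE[n] (F S) ≤ Cⁿ⁺¹ ∫_S J F` and `∫_S J F ≤ Cⁿ⁺¹ μHE[n] (F S)` — a countable
cover of `U` by the neighbourhoods of
`exists_isOpen_euclideanHausdorffMeasure_image_le_and_lintegral_le`, a disjointification, and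
the measurability of the injective continuous images of the pieces (Lusin–Souslin). Federer,
*Geometric Measure Theory* (1969), 3.2.3. [cite: Federer1969, 3.2.3] -/
theorem euclideanHausdorffMeasure_image_le_and_lintegral_le (b : OrthonormalBasis ι ℝ P)
    (hU : IsOpen U) (hF : ∀ x ∈ U, HasFDerivAt F (F' x) x) (hF'c : ContinuousOn F' U)
    (hinj : InjOn F U) (himm : ∀ x ∈ U, Injective (F' x)) {C : ℝ≥0} (hC : 1 < C) {S : Set P}
    (hS : MeasurableSet S) (hSU : S ⊆ U) :
    μHE[finrank ℝ P] (F '' S) ≤ (C : ℝ≥0∞) ^ (finrank ℝ P) * C *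
        ∫⁻ x in S, ENNReal.ofReal (Real.sqrt (Matrix.of fun i j => ⟪F' x (b i), F' x (b j)⟫).det) ∧
      ∫⁻ x in S, ENNReal.ofReal (Real.sqrt (Matrix.of fun i j => ⟪F' x (b i), F' x (b j)⟫).det) ≤
        (C : ℝ≥0∞) ^ (finrank ℝ P) * C * μHE[finrank ℝ P] (F '' S) := by
  classical
  set n := finrank ℝ P with hn
  set g : P → ℝ≥0∞ := fun x =>
    ENNReal.ofReal (Real.sqrt (Matrix.of fun i j => ⟪F' x (b i), F' x (b j)⟫).det) with hg
  rcases S.eq_empty_or_nonempty with rfl | hSne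
  · simp
  have hFc : ContinuousOn F U := fun x hx => (hF x hx).continuousAt.continuousWithinAt
  -- the good neighbourhoods
  choose! W hWo hxW hWU _hWinj hW using
    fun x (hx : x ∈ U) =>
      exists_isOpen_euclideanHausdorffMeasure_image_le_and_lintegral_le b hU hF hF'c hx (himm x hx)
        hC
  -- a countable subcover of `U`
  have hcov : ∀ x ∈ U, W x ∈ 𝓝[U] x := fun x hx =>
    mem_nhdsWithin_of_mem_nhds ((hWo x hx).mem_nhds (hxW x hx))
  obtain ⟨t, htU, ht_count, ht_cover⟩ := TopologicalSpace.countable_cover_nhdsWithin hcov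
  obtain ⟨q₀, hq₀⟩ := hSne
  have htne : t.Nonempty := by
    have : q₀ ∈ ⋃ x ∈ t, W x := ht_cover (hSU hq₀)
    simp only [mem_iUnion] at this
    obtain ⟨x, hx, -⟩ := this
    exact ⟨x, hx⟩
  obtain ⟨e, he⟩ := ht_count.exists_eq_range htne
  have he_mem : ∀ k, e k ∈ U := fun k => htU (he ▸ mem_range_self k)
  -- the open cover `W (e k)` and its disjointification
  set Wk : ℕ → Set P := fun k => W (e k) with hWk
  have hSW : S ⊆ ⋃ k, Wk k := by
    intro q hq
    have : q ∈ ⋃ x ∈ t, W x := ht_cover (hSU hq)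
    simp only [mem_iUnion] at this
    obtain ⟨x, hx, hqx⟩ := this
    rw [he] at hx
    obtain ⟨k, rfl⟩ := hx
    exact mem_iUnion.2 ⟨k, hqx⟩
  set D : ℕ → Set P := disjointed Wk with hD
  set T : ℕ → Set P := fun k => S ∩ D k with hT
  have hTm : ∀ k, MeasurableSet (T k) := fun k =>
    hS.inter (MeasurableSet.disjointed (fun j => (hWo _ (he_mem j)).measurableSet) k)
  have hTd : Pairwise (Function.onFun Disjoint T) := fun i j hij =>
    (disjoint_disjointed Wk hij).mono inter_subset_right inter_subset_right
  have hTS : ∀ k, T k ⊆ S := fun k => inter_subset_left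
  have hTW : ∀ k, T k ⊆ Wk k := fun k => inter_subset_right.trans (disjointed_subset Wk k)
  have hST : S = ⋃ k, T k := by
    rw [hT]
    simp only [← inter_iUnion]
    rw [hD, iUnion_disjointed]
    exact (inter_eq_left.2 hSW).symm
  -- decompose both sides along the pieces `T k`
  have himm' : ∀ k, MeasurableSet (F '' T k) := fun k =>
    measurableSet_image_of_injOn hFc hinj (hTm k) ((hTS k).trans hSU)
  have himd : Pairwise (Function.onFun Disjoint fun k => F '' T k) := fun i j hij =>
    (hTd hij).image hinj ((hTS i).trans hSU) ((hTS j).trans hSU)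
  have hμ : (μHE[n] : Measure V) (F '' S) = ∑' k, (μHE[n] : Measure V) (F '' T k) := by
    conv_lhs => rw [hST, image_iUnion]
    exact measure_iUnion himd himm'
  have hI : ∫⁻ x in S, g x = ∑' k, ∫⁻ x in T k, g x := by
    conv_lhs => rw [hST]
    exact lintegral_iUnion hTm hTd g
  have hk : ∀ k, (μHE[n] : Measure V) (F '' T k) ≤ (C : ℝ≥0∞) ^ n * C * ∫⁻ x in T k, g x
      ∧ ∫⁻ x in T k, g x ≤ (C : ℝ≥0∞) ^ n * C * (μHE[n] : Measure V) (F '' T k) :=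
    fun k => hW (e k) (he_mem k) (T k) (hTW k) (hTm k)
  constructor
  · rw [hμ, hI, ← ENNReal.tsum_mul_left]
    exact ENNReal.tsum_le_tsum (fun k => (hk k).1)
  · rw [hμ, hI, ← ENNReal.tsum_mul_left]
    exact ENNReal.tsum_le_tsum (fun k => (hk k).2)

/-- **The area formula for injective `C¹` immersions** (Mathlib-style form of Federer 3.2.3 in
this case). Let `P` be a finite-dimensional real inner product space of dimension `n`, `V` a real
inner product space, `U ⊆ P` open, `F : P → V` with `HasFDerivAt F (F' x) x` for `x ∈ U`, `F'`
continuous on `U`, `F` injective on `U` and every `F' x` (`x ∈ U`) injective. Then for every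
measurable `S ⊆ U` and every orthonormal basis `b` of `P`,
`μHE[n] (F '' S) = ∫⁻ x in S, √(det (⟪F' x bᵢ, F' x bⱼ⟫)ᵢⱼ)` (Lebesgue measure on `P`), i.e.
`𝓗ⁿ(F(S)) = ∫_S J_n F dx` with the Euclidean normalisation of `𝓗ⁿ`. Federer, *Geometric Measure
Theory* (1969), 3.2.3 and 3.2.5; Evans–Gariepy, *Measure Theory and Fine Properties of
Functions* (1992), §3.3 Thm. 2. [cite: Federer1969, 3.2.3] -/
theorem euclideanHausdorffMeasure_image_eq_lintegral_sqrt_det_gram (b : OrthonormalBasis ι ℝ P)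
    (hU : IsOpen U) (hF : ∀ x ∈ U, HasFDerivAt F (F' x) x) (hF'c : ContinuousOn F' U)
    (hinj : InjOn F U) (himm : ∀ x ∈ U, Injective (F' x)) {S : Set P} (hS : MeasurableSet S)
    (hSU : S ⊆ U) :
    μHE[finrank ℝ P] (F '' S) =
      ∫⁻ x in S, ENNReal.ofReal (Real.sqrt (Matrix.of fun i j => ⟪F' x (b i), F' x (b j)⟫).det) := by
  apply le_antisymm
  · exact Literature.Geometry.Lorentzian.le_of_forall_one_lt_le_pow_mul (finrank ℝ P)
      (fun C hC => (euclideanHausdorffMeasure_image_le_and_lintegral_le b hU hF hF'c hinj himm hC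
        hS hSU).1)
  · exact Literature.Geometry.Lorentzian.le_of_forall_one_lt_le_pow_mul (finrank ℝ P)
      (fun C hC => (euclideanHausdorffMeasure_image_le_and_lintegral_le b hU hF hF'c hinj himm hC
        hS hSU).2)

/-! ### The area formula as an identity of measures and of integrals -/

/-- **The area formula as an identity of measures**: under the hypotheses of
`euclideanHausdorffMeasure_image_eq_lintegral_sqrt_det_gram`, the push-forward under `F` of the
measure `J F · dx ⌞ S` is `μHE[n] ⌞ F(S)` (apply the area formula to the measurable pieces
`S ∩ F⁻¹(B)`). Federer, *Geometric Measure Theory* (1969), 3.2.3, 3.2.5.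
[cite: Federer1969, 3.2.5] -/
theorem map_withDensity_sqrt_det_gram_eq_restrict_image (b : OrthonormalBasis ι ℝ P)
    (hU : IsOpen U) (hF : ∀ x ∈ U, HasFDerivAt F (F' x) x) (hF'c : ContinuousOn F' U)
    (hinj : InjOn F U) (himm : ∀ x ∈ U, Injective (F' x)) {S : Set P} (hS : MeasurableSet S)
    (hSU : S ⊆ U) :
    Measure.map F ((volume.restrict S).withDensity fun x =>
        ENNReal.ofReal (Real.sqrt (Matrix.of fun i j => ⟪F' x (b i), F' x (b j)⟫).det)) =
      (μHE[finrank ℝ P] : Measure V).restrict (F '' S) := by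
  classical
  set J : P → ℝ≥0∞ := fun x =>
    ENNReal.ofReal (Real.sqrt (Matrix.of fun i j => ⟪F' x (b i), F' x (b j)⟫).det) with hJ
  have hFc : ContinuousOn F U := fun x hx => (hF x hx).continuousAt.continuousWithinAt
  have hFae : AEMeasurable F (volume.restrict S) := (hFc.mono hSU).aemeasurable hS
  have hFae' : AEMeasurable F ((volume.restrict S).withDensity J) :=
    hFae.mono_ac (withDensity_absolutelyContinuous _ _)
  -- a measurable modification of `F` off `S`
  have hpw : Measurable (S.piecewise F fun _ => (0 : V)) :=
    (hFc.mono hSU).measurable_piecewise continuousOn_const hS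
  ext B hB
  have hSB : F ⁻¹' B ∩ S = (S.piecewise F fun _ => (0 : V)) ⁻¹' B ∩ S := by
    ext x
    simp only [mem_inter_iff, mem_preimage]
    constructor
    · rintro ⟨hx, hxS⟩; exact ⟨by rwa [piecewise_eq_of_mem _ _ _ hxS], hxS⟩
    · rintro ⟨hx, hxS⟩; exact ⟨by rwa [piecewise_eq_of_mem _ _ _ hxS] at hx, hxS⟩
  have hmeas : MeasurableSet (F ⁻¹' B ∩ S) := by
    rw [hSB]; exact (hpw hB).inter hS
  rw [Measure.map_apply_of_aemeasurable hFae' hB, withDensity_apply' _ (F ⁻¹' B),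
    Measure.restrict_restrict' hS, Measure.restrict_apply hB, inter_comm B (F '' S),
    ← image_inter_preimage F S B, inter_comm S (F ⁻¹' B)]
  exact (euclideanHausdorffMeasure_image_eq_lintegral_sqrt_det_gram b hU hF hF'c hinj himm hmeas
    (inter_subset_right.trans hSU)).symm

/-- **The area formula for integrals** (change of variables along an injective `C¹` immersion):
for every measurable `g : V → [0, ∞]`,
`∫⁻ y in F '' S, g y ∂μHE[n] = ∫⁻ x in S, g (F x) * √(det (⟪F' x bᵢ, F' x bⱼ⟫)ᵢⱼ) dx`.
Federer, *Geometric Measure Theory* (1969), 3.2.5 ("`∫_A g(f(x)) J_m f(x) dx = ∫ g(y) N(f|A, y) d𝓗ᵐ y`",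
here with `N = 1` on `f(A)`). [cite: Federer1969, 3.2.5] -/
theorem lintegral_image_eq_lintegral_mul_sqrt_det_gram (b : OrthonormalBasis ι ℝ P)
    (hU : IsOpen U) (hF : ∀ x ∈ U, HasFDerivAt F (F' x) x) (hF'c : ContinuousOn F' U)
    (hinj : InjOn F U) (himm : ∀ x ∈ U, Injective (F' x)) {S : Set P} (hS : MeasurableSet S)
    (hSU : S ⊆ U) {g : V → ℝ≥0∞} (hg : Measurable g) :
    ∫⁻ y in F '' S, g y ∂(μHE[finrank ℝ P] : Measure V) =
      ∫⁻ x in S, g (F x) *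
        ENNReal.ofReal (Real.sqrt (Matrix.of fun i j => ⟪F' x (b i), F' x (b j)⟫).det) := by
  set J : P → ℝ≥0∞ := fun x =>
    ENNReal.ofReal (Real.sqrt (Matrix.of fun i j => ⟪F' x (b i), F' x (b j)⟫).det) with hJ
  have hFc : ContinuousOn F U := fun x hx => (hF x hx).continuousAt.continuousWithinAt
  have hFae : AEMeasurable F (volume.restrict S) := (hFc.mono hSU).aemeasurable hS
  have hFae' : AEMeasurable F ((volume.restrict S).withDensity J) :=
    hFae.mono_ac (withDensity_absolutelyContinuous _ _)
  have hJae : AEMeasurable J (volume.restrict S) :=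
    ENNReal.measurable_ofReal.comp_aemeasurable
      (((continuousOn_sqrt_det_gram b hF'c).mono hSU).aemeasurable hS)
  rw [← map_withDensity_sqrt_det_gram_eq_restrict_image b hU hF hF'c hinj himm hS hSU,
    lintegral_map' hg.aemeasurable hFae',
    lintegral_withDensity_eq_lintegral_mul_non_measurable₀ _ hJae
      (ae_of_all _ fun x => ENNReal.ofReal_lt_top)]
  refine lintegral_congr fun x => ?_
  simp only [Pi.mul_apply, hJ]
  ring

end AreaFormula

/-! ### The area formula in terms of Mathlib's norm determinant `LinearMap.normDet` -/

section NormDet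

variable {P V : Type*} [NormedAddCommGroup P] [InnerProductSpace ℝ P] [FiniteDimensional ℝ P]
  [NormedAddCommGroup V] [InnerProductSpace ℝ V]
  {ι : Type*} [Fintype ι] [DecidableEq ι]

/-- The Gram density `√(det (⟪A bᵢ, A bⱼ⟫)ᵢⱼ)` is Mathlib's norm determinant `A.normDet` (the
`n`-dimensional Jacobian `‖∧ⁿ A‖`; Mathlib's `LinearMap.normDet_sq_eq_det_gram`). [folklore] -/
theorem sqrt_det_gram_eq_normDet (b : OrthonormalBasis ι ℝ P) (A : P →ₗ[ℝ] V) :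
    Real.sqrt (Matrix.of fun i j => ⟪A (b i), A (b j)⟫).det = A.normDet := by
  have h : (Matrix.of fun i j => ⟪A (b i), A (b j)⟫).det = A.normDet ^ 2 := by
    have := A.normDet_sq_eq_det_gram b
    simpa [Matrix.gram] using this.symm
  rw [h, Real.sqrt_sq (LinearMap.normDet_nonneg A)]

variable [MeasurableSpace P] [BorelSpace P] [MeasurableSpace V] [BorelSpace V]
  {F : P → V} {F' : P → P →L[ℝ] V} {U : Set P}

/-- **The area formula for injective `C¹` immersions, `normDet` form**:
`μHE[n] (F '' S) = ∫⁻ x in S, normDet (F' x)`, the integrand being Mathlib's norm determinant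
(`n`-dimensional Jacobian) of the derivative. Federer, *Geometric Measure Theory* (1969), 3.2.3.
[cite: Federer1969, 3.2.3] -/
theorem euclideanHausdorffMeasure_image_eq_lintegral_normDet (hU : IsOpen U)
    (hF : ∀ x ∈ U, HasFDerivAt F (F' x) x) (hF'c : ContinuousOn F' U) (hinj : InjOn F U)
    (himm : ∀ x ∈ U, Injective (F' x)) {S : Set P} (hS : MeasurableSet S) (hSU : S ⊆ U) :
    μHE[finrank ℝ P] (F '' S) = ∫⁻ x in S, ENNReal.ofReal ((F' x : P →ₗ[ℝ] V).normDet) := by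
  rw [euclideanHausdorffMeasure_image_eq_lintegral_sqrt_det_gram (stdOrthonormalBasis ℝ P) hU hF hF'c
    hinj himm hS hSU]
  refine setLIntegral_congr_fun hS (fun x _ => ?_)
  rw [← sqrt_det_gram_eq_normDet (stdOrthonormalBasis ℝ P) (F' x : P →ₗ[ℝ] V)]
  rfl

/-- **The area formula as an identity of measures, `normDet` form**: the push-forward under `F` of
`normDet (F' x) dx ⌞ S` is `μHE[n] ⌞ F(S)`. [cite: Federer1969, 3.2.5] -/
theorem map_withDensity_normDet_eq_restrict_image (hU : IsOpen U)
    (hF : ∀ x ∈ U, HasFDerivAt F (F' x) x) (hF'c : ContinuousOn F' U) (hinj : InjOn F U)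
    (himm : ∀ x ∈ U, Injective (F' x)) {S : Set P} (hS : MeasurableSet S) (hSU : S ⊆ U) :
    Measure.map F ((volume.restrict S).withDensity fun x =>
        ENNReal.ofReal ((F' x : P →ₗ[ℝ] V).normDet)) =
      (μHE[finrank ℝ P] : Measure V).restrict (F '' S) := by
  rw [← map_withDensity_sqrt_det_gram_eq_restrict_image (stdOrthonormalBasis ℝ P) hU hF hF'c hinj
    himm hS hSU]
  congr 2
  funext x
  rw [← sqrt_det_gram_eq_normDet (stdOrthonormalBasis ℝ P) (F' x : P →ₗ[ℝ] V)]
  rfl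

/-- **The area formula for integrals, `normDet` form**: for measurable `g : V → [0, ∞]`,
`∫⁻ y in F '' S, g y ∂μHE[n] = ∫⁻ x in S, g (F x) * normDet (F' x)`. [cite: Federer1969, 3.2.5] -/
theorem lintegral_image_eq_lintegral_mul_normDet (hU : IsOpen U)
    (hF : ∀ x ∈ U, HasFDerivAt F (F' x) x) (hF'c : ContinuousOn F' U) (hinj : InjOn F U)
    (himm : ∀ x ∈ U, Injective (F' x)) {S : Set P} (hS : MeasurableSet S) (hSU : S ⊆ U)
    {g : V → ℝ≥0∞} (hg : Measurable g) :
    ∫⁻ y in F '' S, g y ∂(μHE[finrank ℝ P] : Measure V) =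
      ∫⁻ x in S, g (F x) * ENNReal.ofReal ((F' x : P →ₗ[ℝ] V).normDet) := by
  rw [lintegral_image_eq_lintegral_mul_sqrt_det_gram (stdOrthonormalBasis ℝ P) hU hF hF'c hinj himm
    hS hSU hg]
  refine setLIntegral_congr_fun hS (fun x _ => ?_)
  rw [← sqrt_det_gram_eq_normDet (stdOrthonormalBasis ℝ P) (F' x : P →ₗ[ℝ] V)]
  rfl

/-- **Area formula for `C¹` maps given by `fderiv`**: if `F` is `C¹` on the open set `U`
(`ContDiffOn ℝ 1`), injective on `U`, with injective differentials `fderiv ℝ F x`, then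
`μHE[n] (F '' S) = ∫⁻ x in S, normDet (fderiv ℝ F x)` for measurable `S ⊆ U`.
[cite: Federer1969, 3.2.3] -/
theorem euclideanHausdorffMeasure_image_eq_lintegral_normDet_fderiv (hU : IsOpen U)
    (hF : ContDiffOn ℝ 1 F U) (hinj : InjOn F U) (himm : ∀ x ∈ U, Injective (fderiv ℝ F x))
    {S : Set P} (hS : MeasurableSet S) (hSU : S ⊆ U) :
    μHE[finrank ℝ P] (F '' S) = ∫⁻ x in S, ENNReal.ofReal ((fderiv ℝ F x : P →ₗ[ℝ] V).normDet) :=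
  euclideanHausdorffMeasure_image_eq_lintegral_normDet hU
    (fun _ hx => ((hF.differentiableOn one_ne_zero).differentiableAt (hU.mem_nhds hx)).hasFDerivAt)
    (hF.continuousOn_fderiv_of_isOpen hU le_rfl) hinj himm hS hSU

end NormDet

end Literature.Geometry.GeometricMeasureTheory

end
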